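import Summits.BirchSwinnertonDyer.Rank1Residual.P2.CongruentNumberPairsAtTwoOdd
import Literature.NumberTheory.EllipticCurves.CongruentNumberMonskySelmerRankZero
import HarnessLib

/-!
# Sub-lane «bsd-p2» / cell `bsd-monsky`: the odd `s(n) = 0` PAIRS WITHOUT Monsky's named fact —
# `#Sel₂(E_n) = 4` (hence rank `0` and `Ш(E_n)[2^∞] = 0`) UNCONDITIONALLY for the 17 odd `n ∈ U_CN` with `det M = 1`,
# and `BSD(E_n, 2)` for them modulo the three JOURNAL facts {Burungale–Tian, Deuring–Hecke, Burungale–Flach} ONLY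

HONEST FRAMING (sub-lane «bsd-p2», run/shared/lean/b2b/bsd-rank1-residual/p2/; cell `bsd-monsky`, run/shared/lean/pub/bsd-monsky/): the
target of record is the FULL Birch–Swinnerton-Dyer formula for EVERY analytic-rank `≤ 1` `E/ℚ` at ALL primes INCLUDING `2`; the `2`-part is
under census. The landed instance file `P2/CongruentNumberPairsAtTwoOdd.lean` (odd `n ∈ {1, 3, 11, 19, 33, 35, 43, 51, 57, 59, 67, 83, 91, 105, 107, 115, 123}`) closes `BSD(E_n, 2)` on the JOURNAL
door modulo FOUR named facts: Monsky's `2`-descent matrix theorem `hM` (odd case, `n = p₁⋯p_k`) + `hBT` + `hH` + `hBF`, the census membership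
`s(n) = 0` being the kernel-decided `det M = 1` (`det_monskyMatrixOdd_n` there). The tree now PROVES the upper-bound half of Monsky's formula
(`Literature/…/CongruentNumberOddMonskySelmerBound.lean`) and hence, fact-free, `det M = 1 ⟹ #Sel₂(E_n) = 4 ⟹ rk E_n(ℚ) = 0 ∧ Ш(E_n)[2^∞] = 0`
(`Literature/…/CongruentNumberMonskySelmerRankZero.lean`). THIS FILE re-runs the instance file on that: §1 the door with `hM` struck
(`bsdp_two_congruentNumberCurve_of_det_odd_descent`, journal facts only; modularity-leaf variant `'`); §2 per-`n` instances
`card_selmerGroup_two_congruentNumberCurve_n` (UNCONDITIONAL) / `bsdp_two_congruentNumberCurve_n_descent` and the ROLL-UPS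
**`card_selmerGroup_two_eq_four_of_mem_oddList`, `rank_zero_sha_two_of_mem_oddList` — UNCONDITIONAL** (rank `0` and `Ш[2^∞] = 0` for these
17 curves with NO named fact) and `bsdp_two_congruentNumberCurve_of_mem_oddList_descent` (modulo {`hBT`, `hH`, `hBF`} ONLY). Companion: `…EvenDescent.lean`.
Nothing booked by this file; the lane's marks and the PARTITION are the lead's / director's business.

References: [HeathBrown1994SelmerCongruentII] Appendix (Monsky), typescript p. 39 L10–L33; [SilvermanAEC2009] Thm. X.4.2; [BurungaleTian2026] Thm. 1.1;
[BurungaleFlach2024] Thm. 1.1, Cor. 2; [BCDTJAMS2001] Theorem A; [Miller2011LMS] Def. 1.1.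
-/

noncomputable section

open scoped Classical

open Matrix Finset WeierstrassCurve Literature.NumberTheory.EllipticCurves
  Literature.NumberTheory.EllipticCurves.Rank1Residual
  Literature.NumberTheory.EllipticCurves.Rank1Residual.Typed
  Literature.NumberTheory.EllipticCurves.HeathBrown1994
  Literature.NumberTheory.EllipticCurves.CongruentNumberMonskySelmer

set_option autoImplicit false

namespace Summit.BirchSwinnertonDyer.Rank1Residual.P2

/-! ## §1 The `det M = 1` door (odd `n`) with Monsky's fact struck -/

section Doors

variable {k : ℕ} (p : Fin k → ℕ)

/-- **JOURNAL door, odd `n = p₁⋯p_k`, WITHOUT Monsky's fact**: `det M = 1` + {`hBT`, `hH`, `hBF`} ⟹ `BSD(E_n, 2)`.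
[cite: HeathBrown1994SelmerCongruentII, Appendix (Monsky), typescript p. 39 L10–L33] [cite: BurungaleTian2026, Thm. 1.1]
[cite: BurungaleFlach2024, Thm. 1.1 and Cor. 2] [cite: Miller2011LMS, Def. 1.1] -/
theorem bsdp_two_congruentNumberCurve_of_det_odd_descent
    (hBT : burungaleTian_analyticRank_eq_zero_of_selmerCorank_eq_zero_of_hasCM)
    (hH : hasEntireLFunction_of_j_mem_maximalCMJInvariants) (hBF : bsdTriple_of_hasCM_of_L_one_ne_zero)
    (hp : ∀ i, (p i).Prime) (hodd : ∀ i, Odd (p i)) (hinj : Function.Injective p)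
    (hdet : (monskyMatrixOdd p).det = 1) {n : ℕ} (hn : ∏ i, p i = n) :
    BSDp (congruentNumberCurve n) 2 := by
  subst hn
  exact forall_bsdp_of_BT_BF_odd_descent p hBT hH hBF hp hodd hinj hdet 2 Nat.prime_two

/-- The journal door with the MODULARITY leaf (`hasEntireLFunction_rat`) in place of Deuring–Hecke, odd `n`, WITHOUT Monsky's fact.
[cite: BurungaleTian2026, Thm. 1.1] [cite: BurungaleFlach2024, Cor. 2] [cite: BCDTJAMS2001, Theorem A] -/
theorem bsdp_two_congruentNumberCurve_of_det_odd_descent'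
    (hBT : burungaleTian_analyticRank_eq_zero_of_selmerCorank_eq_zero_of_hasCM)
    (hmod : hasEntireLFunction_rat) (hBF : bsdTriple_of_hasCM_of_L_one_ne_zero)
    (hp : ∀ i, (p i).Prime) (hodd : ∀ i, Odd (p i)) (hinj : Function.Injective p)
    (hdet : (monskyMatrixOdd p).det = 1) {n : ℕ} (hn : ∏ i, p i = n) :
    BSDp (congruentNumberCurve n) 2 :=
  bsdp_two_congruentNumberCurve_of_det_odd_descent p hBT
    (hasEntireLFunction_of_j_mem_maximalCMJInvariants_of_hasEntireLFunction_rat hmod) hBF hp hodd hinj hdet hn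

end Doors

/-! ## §2 The 17 instances: `#Sel₂(E_n) = 4` unconditionally; `BSD(E_n, 2)` modulo the journal facts only -/

section Instances

/-- **`#Sel⁽²⁾(E_{1}/ℚ) = 4` — UNCONDITIONAL** (`det M = 1` for `n = 1`, `det_monskyMatrixOdd_1`; hence rank `0`, `Ш[2^∞] = 0`).
[cite: HeathBrown1994SelmerCongruentII, Appendix (Monsky), typescript p. 39 L10–L33] [cite: SilvermanAEC2009, Thm. X.4.2] -/
theorem card_selmerGroup_two_congruentNumberCurve_1 : Nat.card ((congruentNumberCurve 1).selmerGroup 2) = 4 :=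
  card_selmerGroup_two_eq_four_of_det_odd' (![] : Fin 0 → ℕ) (by simp) (fun i => i.elim0) (fun i => i.elim0) (Function.injective_of_subsingleton _) det_monskyMatrixOdd_1

/-- **`BSD(E_{1}, 2)` WITHOUT Monsky's fact** — journal door {`hBT`, `hH`, `hBF`} only; membership `s(1) = 0` by `det_monskyMatrixOdd_1`.
[cite: BurungaleTian2026, Thm. 1.1] [cite: BurungaleFlach2024, Cor. 2] [cite: Miller2011LMS, Def. 1.1] -/
theorem bsdp_two_congruentNumberCurve_1_descent
    (hBT : burungaleTian_analyticRank_eq_zero_of_selmerCorank_eq_zero_of_hasCM)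
    (hH : hasEntireLFunction_of_j_mem_maximalCMJInvariants) (hBF : bsdTriple_of_hasCM_of_L_one_ne_zero) :
    BSDp (congruentNumberCurve 1) 2 :=
  bsdp_two_congruentNumberCurve_of_det_odd_descent (![] : Fin 0 → ℕ) hBT hH hBF (fun i => i.elim0) (fun i => i.elim0) (Function.injective_of_subsingleton _) det_monskyMatrixOdd_1 (by simp)

/-- **`#Sel⁽²⁾(E_{3}/ℚ) = 4` — UNCONDITIONAL** (`det M = 1` for `n = 3`, `det_monskyMatrixOdd_3`; hence rank `0`, `Ш[2^∞] = 0`).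
[cite: HeathBrown1994SelmerCongruentII, Appendix (Monsky), typescript p. 39 L10–L33] [cite: SilvermanAEC2009, Thm. X.4.2] -/
theorem card_selmerGroup_two_congruentNumberCurve_3 : Nat.card ((congruentNumberCurve 3).selmerGroup 2) = 4 :=
  card_selmerGroup_two_eq_four_of_det_odd' ![3] (by simp) (by intro i; fin_cases i; norm_num) (by intro i; fin_cases i; decide) (by decide) det_monskyMatrixOdd_3

/-- **`BSD(E_{3}, 2)` WITHOUT Monsky's fact** — journal door {`hBT`, `hH`, `hBF`} only; membership `s(3) = 0` by `det_monskyMatrixOdd_3`.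
[cite: BurungaleTian2026, Thm. 1.1] [cite: BurungaleFlach2024, Cor. 2] [cite: Miller2011LMS, Def. 1.1] -/
theorem bsdp_two_congruentNumberCurve_3_descent
    (hBT : burungaleTian_analyticRank_eq_zero_of_selmerCorank_eq_zero_of_hasCM)
    (hH : hasEntireLFunction_of_j_mem_maximalCMJInvariants) (hBF : bsdTriple_of_hasCM_of_L_one_ne_zero) :
    BSDp (congruentNumberCurve 3) 2 :=
  bsdp_two_congruentNumberCurve_of_det_odd_descent ![3] hBT hH hBF (by intro i; fin_cases i; norm_num) (by intro i; fin_cases i; decide) (by decide) det_monskyMatrixOdd_3 (by simp)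

/-- **`#Sel⁽²⁾(E_{11}/ℚ) = 4` — UNCONDITIONAL** (`det M = 1` for `n = 11`, `det_monskyMatrixOdd_11`; hence rank `0`, `Ш[2^∞] = 0`).
[cite: HeathBrown1994SelmerCongruentII, Appendix (Monsky), typescript p. 39 L10–L33] [cite: SilvermanAEC2009, Thm. X.4.2] -/
theorem card_selmerGroup_two_congruentNumberCurve_11 : Nat.card ((congruentNumberCurve 11).selmerGroup 2) = 4 :=
  card_selmerGroup_two_eq_four_of_det_odd' ![11] (by simp) (by intro i; fin_cases i; norm_num) (by intro i; fin_cases i; decide) (by decide) det_monskyMatrixOdd_11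

/-- **`BSD(E_{11}, 2)` WITHOUT Monsky's fact** — journal door {`hBT`, `hH`, `hBF`} only; membership `s(11) = 0` by `det_monskyMatrixOdd_11`.
[cite: BurungaleTian2026, Thm. 1.1] [cite: BurungaleFlach2024, Cor. 2] [cite: Miller2011LMS, Def. 1.1] -/
theorem bsdp_two_congruentNumberCurve_11_descent
    (hBT : burungaleTian_analyticRank_eq_zero_of_selmerCorank_eq_zero_of_hasCM)
    (hH : hasEntireLFunction_of_j_mem_maximalCMJInvariants) (hBF : bsdTriple_of_hasCM_of_L_one_ne_zero) :
    BSDp (congruentNumberCurve 11) 2 :=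
  bsdp_two_congruentNumberCurve_of_det_odd_descent ![11] hBT hH hBF (by intro i; fin_cases i; norm_num) (by intro i; fin_cases i; decide) (by decide) det_monskyMatrixOdd_11 (by simp)

/-- **`#Sel⁽²⁾(E_{19}/ℚ) = 4` — UNCONDITIONAL** (`det M = 1` for `n = 19`, `det_monskyMatrixOdd_19`; hence rank `0`, `Ш[2^∞] = 0`).
[cite: HeathBrown1994SelmerCongruentII, Appendix (Monsky), typescript p. 39 L10–L33] [cite: SilvermanAEC2009, Thm. X.4.2] -/
theorem card_selmerGroup_two_congruentNumberCurve_19 : Nat.card ((congruentNumberCurve 19).selmerGroup 2) = 4 :=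
  card_selmerGroup_two_eq_four_of_det_odd' ![19] (by simp) (by intro i; fin_cases i; norm_num) (by intro i; fin_cases i; decide) (by decide) det_monskyMatrixOdd_19

/-- **`BSD(E_{19}, 2)` WITHOUT Monsky's fact** — journal door {`hBT`, `hH`, `hBF`} only; membership `s(19) = 0` by `det_monskyMatrixOdd_19`.
[cite: BurungaleTian2026, Thm. 1.1] [cite: BurungaleFlach2024, Cor. 2] [cite: Miller2011LMS, Def. 1.1] -/
theorem bsdp_two_congruentNumberCurve_19_descent
    (hBT : burungaleTian_analyticRank_eq_zero_of_selmerCorank_eq_zero_of_hasCM)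
    (hH : hasEntireLFunction_of_j_mem_maximalCMJInvariants) (hBF : bsdTriple_of_hasCM_of_L_one_ne_zero) :
    BSDp (congruentNumberCurve 19) 2 :=
  bsdp_two_congruentNumberCurve_of_det_odd_descent ![19] hBT hH hBF (by intro i; fin_cases i; norm_num) (by intro i; fin_cases i; decide) (by decide) det_monskyMatrixOdd_19 (by simp)

/-- **`#Sel⁽²⁾(E_{33}/ℚ) = 4` — UNCONDITIONAL** (`det M = 1` for `n = 33`, `det_monskyMatrixOdd_33`; hence rank `0`, `Ш[2^∞] = 0`).
[cite: HeathBrown1994SelmerCongruentII, Appendix (Monsky), typescript p. 39 L10–L33] [cite: SilvermanAEC2009, Thm. X.4.2] -/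
theorem card_selmerGroup_two_congruentNumberCurve_33 : Nat.card ((congruentNumberCurve 33).selmerGroup 2) = 4 :=
  card_selmerGroup_two_eq_four_of_det_odd' ![3, 11] (by simp [Fin.prod_univ_succ]) (by intro i; fin_cases i <;> norm_num) (by intro i; fin_cases i <;> decide) (by decide) det_monskyMatrixOdd_33

/-- **`BSD(E_{33}, 2)` WITHOUT Monsky's fact** — journal door {`hBT`, `hH`, `hBF`} only; membership `s(33) = 0` by `det_monskyMatrixOdd_33`.
[cite: BurungaleTian2026, Thm. 1.1] [cite: BurungaleFlach2024, Cor. 2] [cite: Miller2011LMS, Def. 1.1] -/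
theorem bsdp_two_congruentNumberCurve_33_descent
    (hBT : burungaleTian_analyticRank_eq_zero_of_selmerCorank_eq_zero_of_hasCM)
    (hH : hasEntireLFunction_of_j_mem_maximalCMJInvariants) (hBF : bsdTriple_of_hasCM_of_L_one_ne_zero) :
    BSDp (congruentNumberCurve 33) 2 :=
  bsdp_two_congruentNumberCurve_of_det_odd_descent ![3, 11] hBT hH hBF (by intro i; fin_cases i <;> norm_num) (by intro i; fin_cases i <;> decide) (by decide) det_monskyMatrixOdd_33 (by simp [Fin.prod_univ_succ])

/-- **`#Sel⁽²⁾(E_{35}/ℚ) = 4` — UNCONDITIONAL** (`det M = 1` for `n = 35`, `det_monskyMatrixOdd_35`; hence rank `0`, `Ш[2^∞] = 0`).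
[cite: HeathBrown1994SelmerCongruentII, Appendix (Monsky), typescript p. 39 L10–L33] [cite: SilvermanAEC2009, Thm. X.4.2] -/
theorem card_selmerGroup_two_congruentNumberCurve_35 : Nat.card ((congruentNumberCurve 35).selmerGroup 2) = 4 :=
  card_selmerGroup_two_eq_four_of_det_odd' ![5, 7] (by simp [Fin.prod_univ_succ]) (by intro i; fin_cases i <;> norm_num) (by intro i; fin_cases i <;> decide) (by decide) det_monskyMatrixOdd_35

/-- **`BSD(E_{35}, 2)` WITHOUT Monsky's fact** — journal door {`hBT`, `hH`, `hBF`} only; membership `s(35) = 0` by `det_monskyMatrixOdd_35`.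
[cite: BurungaleTian2026, Thm. 1.1] [cite: BurungaleFlach2024, Cor. 2] [cite: Miller2011LMS, Def. 1.1] -/
theorem bsdp_two_congruentNumberCurve_35_descent
    (hBT : burungaleTian_analyticRank_eq_zero_of_selmerCorank_eq_zero_of_hasCM)
    (hH : hasEntireLFunction_of_j_mem_maximalCMJInvariants) (hBF : bsdTriple_of_hasCM_of_L_one_ne_zero) :
    BSDp (congruentNumberCurve 35) 2 :=
  bsdp_two_congruentNumberCurve_of_det_odd_descent ![5, 7] hBT hH hBF (by intro i; fin_cases i <;> norm_num) (by intro i; fin_cases i <;> decide) (by decide) det_monskyMatrixOdd_35 (by simp [Fin.prod_univ_succ])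

/-- **`#Sel⁽²⁾(E_{43}/ℚ) = 4` — UNCONDITIONAL** (`det M = 1` for `n = 43`, `det_monskyMatrixOdd_43`; hence rank `0`, `Ш[2^∞] = 0`).
[cite: HeathBrown1994SelmerCongruentII, Appendix (Monsky), typescript p. 39 L10–L33] [cite: SilvermanAEC2009, Thm. X.4.2] -/
theorem card_selmerGroup_two_congruentNumberCurve_43 : Nat.card ((congruentNumberCurve 43).selmerGroup 2) = 4 :=
  card_selmerGroup_two_eq_four_of_det_odd' ![43] (by simp) (by intro i; fin_cases i; norm_num) (by intro i; fin_cases i; decide) (by decide) det_monskyMatrixOdd_43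

/-- **`BSD(E_{43}, 2)` WITHOUT Monsky's fact** — journal door {`hBT`, `hH`, `hBF`} only; membership `s(43) = 0` by `det_monskyMatrixOdd_43`.
[cite: BurungaleTian2026, Thm. 1.1] [cite: BurungaleFlach2024, Cor. 2] [cite: Miller2011LMS, Def. 1.1] -/
theorem bsdp_two_congruentNumberCurve_43_descent
    (hBT : burungaleTian_analyticRank_eq_zero_of_selmerCorank_eq_zero_of_hasCM)
    (hH : hasEntireLFunction_of_j_mem_maximalCMJInvariants) (hBF : bsdTriple_of_hasCM_of_L_one_ne_zero) :
    BSDp (congruentNumberCurve 43) 2 :=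
  bsdp_two_congruentNumberCurve_of_det_odd_descent ![43] hBT hH hBF (by intro i; fin_cases i; norm_num) (by intro i; fin_cases i; decide) (by decide) det_monskyMatrixOdd_43 (by simp)

/-- **`#Sel⁽²⁾(E_{51}/ℚ) = 4` — UNCONDITIONAL** (`det M = 1` for `n = 51`, `det_monskyMatrixOdd_51`; hence rank `0`, `Ш[2^∞] = 0`).
[cite: HeathBrown1994SelmerCongruentII, Appendix (Monsky), typescript p. 39 L10–L33] [cite: SilvermanAEC2009, Thm. X.4.2] -/
theorem card_selmerGroup_two_congruentNumberCurve_51 : Nat.card ((congruentNumberCurve 51).selmerGroup 2) = 4 :=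
  card_selmerGroup_two_eq_four_of_det_odd' ![3, 17] (by simp [Fin.prod_univ_succ]) (by intro i; fin_cases i <;> norm_num) (by intro i; fin_cases i <;> decide) (by decide) det_monskyMatrixOdd_51

/-- **`BSD(E_{51}, 2)` WITHOUT Monsky's fact** — journal door {`hBT`, `hH`, `hBF`} only; membership `s(51) = 0` by `det_monskyMatrixOdd_51`.
[cite: BurungaleTian2026, Thm. 1.1] [cite: BurungaleFlach2024, Cor. 2] [cite: Miller2011LMS, Def. 1.1] -/
theorem bsdp_two_congruentNumberCurve_51_descent
    (hBT : burungaleTian_analyticRank_eq_zero_of_selmerCorank_eq_zero_of_hasCM)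
    (hH : hasEntireLFunction_of_j_mem_maximalCMJInvariants) (hBF : bsdTriple_of_hasCM_of_L_one_ne_zero) :
    BSDp (congruentNumberCurve 51) 2 :=
  bsdp_two_congruentNumberCurve_of_det_odd_descent ![3, 17] hBT hH hBF (by intro i; fin_cases i <;> norm_num) (by intro i; fin_cases i <;> decide) (by decide) det_monskyMatrixOdd_51 (by simp [Fin.prod_univ_succ])

/-- **`#Sel⁽²⁾(E_{57}/ℚ) = 4` — UNCONDITIONAL** (`det M = 1` for `n = 57`, `det_monskyMatrixOdd_57`; hence rank `0`, `Ш[2^∞] = 0`).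
[cite: HeathBrown1994SelmerCongruentII, Appendix (Monsky), typescript p. 39 L10–L33] [cite: SilvermanAEC2009, Thm. X.4.2] -/
theorem card_selmerGroup_two_congruentNumberCurve_57 : Nat.card ((congruentNumberCurve 57).selmerGroup 2) = 4 :=
  card_selmerGroup_two_eq_four_of_det_odd' ![3, 19] (by simp [Fin.prod_univ_succ]) (by intro i; fin_cases i <;> norm_num) (by intro i; fin_cases i <;> decide) (by decide) det_monskyMatrixOdd_57

/-- **`BSD(E_{57}, 2)` WITHOUT Monsky's fact** — journal door {`hBT`, `hH`, `hBF`} only; membership `s(57) = 0` by `det_monskyMatrixOdd_57`.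
[cite: BurungaleTian2026, Thm. 1.1] [cite: BurungaleFlach2024, Cor. 2] [cite: Miller2011LMS, Def. 1.1] -/
theorem bsdp_two_congruentNumberCurve_57_descent
    (hBT : burungaleTian_analyticRank_eq_zero_of_selmerCorank_eq_zero_of_hasCM)
    (hH : hasEntireLFunction_of_j_mem_maximalCMJInvariants) (hBF : bsdTriple_of_hasCM_of_L_one_ne_zero) :
    BSDp (congruentNumberCurve 57) 2 :=
  bsdp_two_congruentNumberCurve_of_det_odd_descent ![3, 19] hBT hH hBF (by intro i; fin_cases i <;> norm_num) (by intro i; fin_cases i <;> decide) (by decide) det_monskyMatrixOdd_57 (by simp [Fin.prod_univ_succ])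

/-- **`#Sel⁽²⁾(E_{59}/ℚ) = 4` — UNCONDITIONAL** (`det M = 1` for `n = 59`, `det_monskyMatrixOdd_59`; hence rank `0`, `Ш[2^∞] = 0`).
[cite: HeathBrown1994SelmerCongruentII, Appendix (Monsky), typescript p. 39 L10–L33] [cite: SilvermanAEC2009, Thm. X.4.2] -/
theorem card_selmerGroup_two_congruentNumberCurve_59 : Nat.card ((congruentNumberCurve 59).selmerGroup 2) = 4 :=
  card_selmerGroup_two_eq_four_of_det_odd' ![59] (by simp) (by intro i; fin_cases i; norm_num) (by intro i; fin_cases i; decide) (by decide) det_monskyMatrixOdd_59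

/-- **`BSD(E_{59}, 2)` WITHOUT Monsky's fact** — journal door {`hBT`, `hH`, `hBF`} only; membership `s(59) = 0` by `det_monskyMatrixOdd_59`.
[cite: BurungaleTian2026, Thm. 1.1] [cite: BurungaleFlach2024, Cor. 2] [cite: Miller2011LMS, Def. 1.1] -/
theorem bsdp_two_congruentNumberCurve_59_descent
    (hBT : burungaleTian_analyticRank_eq_zero_of_selmerCorank_eq_zero_of_hasCM)
    (hH : hasEntireLFunction_of_j_mem_maximalCMJInvariants) (hBF : bsdTriple_of_hasCM_of_L_one_ne_zero) :
    BSDp (congruentNumberCurve 59) 2 :=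
  bsdp_two_congruentNumberCurve_of_det_odd_descent ![59] hBT hH hBF (by intro i; fin_cases i; norm_num) (by intro i; fin_cases i; decide) (by decide) det_monskyMatrixOdd_59 (by simp)

/-- **`#Sel⁽²⁾(E_{67}/ℚ) = 4` — UNCONDITIONAL** (`det M = 1` for `n = 67`, `det_monskyMatrixOdd_67`; hence rank `0`, `Ш[2^∞] = 0`).
[cite: HeathBrown1994SelmerCongruentII, Appendix (Monsky), typescript p. 39 L10–L33] [cite: SilvermanAEC2009, Thm. X.4.2] -/
theorem card_selmerGroup_two_congruentNumberCurve_67 : Nat.card ((congruentNumberCurve 67).selmerGroup 2) = 4 :=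
  card_selmerGroup_two_eq_four_of_det_odd' ![67] (by simp) (by intro i; fin_cases i; norm_num) (by intro i; fin_cases i; decide) (by decide) det_monskyMatrixOdd_67

/-- **`BSD(E_{67}, 2)` WITHOUT Monsky's fact** — journal door {`hBT`, `hH`, `hBF`} only; membership `s(67) = 0` by `det_monskyMatrixOdd_67`.
[cite: BurungaleTian2026, Thm. 1.1] [cite: BurungaleFlach2024, Cor. 2] [cite: Miller2011LMS, Def. 1.1] -/
theorem bsdp_two_congruentNumberCurve_67_descent
    (hBT : burungaleTian_analyticRank_eq_zero_of_selmerCorank_eq_zero_of_hasCM)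
    (hH : hasEntireLFunction_of_j_mem_maximalCMJInvariants) (hBF : bsdTriple_of_hasCM_of_L_one_ne_zero) :
    BSDp (congruentNumberCurve 67) 2 :=
  bsdp_two_congruentNumberCurve_of_det_odd_descent ![67] hBT hH hBF (by intro i; fin_cases i; norm_num) (by intro i; fin_cases i; decide) (by decide) det_monskyMatrixOdd_67 (by simp)

/-- **`#Sel⁽²⁾(E_{83}/ℚ) = 4` — UNCONDITIONAL** (`det M = 1` for `n = 83`, `det_monskyMatrixOdd_83`; hence rank `0`, `Ш[2^∞] = 0`).
[cite: HeathBrown1994SelmerCongruentII, Appendix (Monsky), typescript p. 39 L10–L33] [cite: SilvermanAEC2009, Thm. X.4.2] -/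
theorem card_selmerGroup_two_congruentNumberCurve_83 : Nat.card ((congruentNumberCurve 83).selmerGroup 2) = 4 :=
  card_selmerGroup_two_eq_four_of_det_odd' ![83] (by simp) (by intro i; fin_cases i; norm_num) (by intro i; fin_cases i; decide) (by decide) det_monskyMatrixOdd_83

/-- **`BSD(E_{83}, 2)` WITHOUT Monsky's fact** — journal door {`hBT`, `hH`, `hBF`} only; membership `s(83) = 0` by `det_monskyMatrixOdd_83`.
[cite: BurungaleTian2026, Thm. 1.1] [cite: BurungaleFlach2024, Cor. 2] [cite: Miller2011LMS, Def. 1.1] -/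
theorem bsdp_two_congruentNumberCurve_83_descent
    (hBT : burungaleTian_analyticRank_eq_zero_of_selmerCorank_eq_zero_of_hasCM)
    (hH : hasEntireLFunction_of_j_mem_maximalCMJInvariants) (hBF : bsdTriple_of_hasCM_of_L_one_ne_zero) :
    BSDp (congruentNumberCurve 83) 2 :=
  bsdp_two_congruentNumberCurve_of_det_odd_descent ![83] hBT hH hBF (by intro i; fin_cases i; norm_num) (by intro i; fin_cases i; decide) (by decide) det_monskyMatrixOdd_83 (by simp)

/-- **`#Sel⁽²⁾(E_{91}/ℚ) = 4` — UNCONDITIONAL** (`det M = 1` for `n = 91`, `det_monskyMatrixOdd_91`; hence rank `0`, `Ш[2^∞] = 0`).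
[cite: HeathBrown1994SelmerCongruentII, Appendix (Monsky), typescript p. 39 L10–L33] [cite: SilvermanAEC2009, Thm. X.4.2] -/
theorem card_selmerGroup_two_congruentNumberCurve_91 : Nat.card ((congruentNumberCurve 91).selmerGroup 2) = 4 :=
  card_selmerGroup_two_eq_four_of_det_odd' ![7, 13] (by simp [Fin.prod_univ_succ]) (by intro i; fin_cases i <;> norm_num) (by intro i; fin_cases i <;> decide) (by decide) det_monskyMatrixOdd_91

/-- **`BSD(E_{91}, 2)` WITHOUT Monsky's fact** — journal door {`hBT`, `hH`, `hBF`} only; membership `s(91) = 0` by `det_monskyMatrixOdd_91`.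
[cite: BurungaleTian2026, Thm. 1.1] [cite: BurungaleFlach2024, Cor. 2] [cite: Miller2011LMS, Def. 1.1] -/
theorem bsdp_two_congruentNumberCurve_91_descent
    (hBT : burungaleTian_analyticRank_eq_zero_of_selmerCorank_eq_zero_of_hasCM)
    (hH : hasEntireLFunction_of_j_mem_maximalCMJInvariants) (hBF : bsdTriple_of_hasCM_of_L_one_ne_zero) :
    BSDp (congruentNumberCurve 91) 2 :=
  bsdp_two_congruentNumberCurve_of_det_odd_descent ![7, 13] hBT hH hBF (by intro i; fin_cases i <;> norm_num) (by intro i; fin_cases i <;> decide) (by decide) det_monskyMatrixOdd_91 (by simp [Fin.prod_univ_succ])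

/-- **`#Sel⁽²⁾(E_{105}/ℚ) = 4` — UNCONDITIONAL** (`det M = 1` for `n = 105`, `det_monskyMatrixOdd_105`; hence rank `0`, `Ш[2^∞] = 0`).
[cite: HeathBrown1994SelmerCongruentII, Appendix (Monsky), typescript p. 39 L10–L33] [cite: SilvermanAEC2009, Thm. X.4.2] -/
theorem card_selmerGroup_two_congruentNumberCurve_105 : Nat.card ((congruentNumberCurve 105).selmerGroup 2) = 4 :=
  card_selmerGroup_two_eq_four_of_det_odd' ![3, 5, 7] (by simp [Fin.prod_univ_succ]) (by intro i; fin_cases i <;> norm_num) (by intro i; fin_cases i <;> decide) (by decide) det_monskyMatrixOdd_105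

/-- **`BSD(E_{105}, 2)` WITHOUT Monsky's fact** — journal door {`hBT`, `hH`, `hBF`} only; membership `s(105) = 0` by `det_monskyMatrixOdd_105`.
[cite: BurungaleTian2026, Thm. 1.1] [cite: BurungaleFlach2024, Cor. 2] [cite: Miller2011LMS, Def. 1.1] -/
theorem bsdp_two_congruentNumberCurve_105_descent
    (hBT : burungaleTian_analyticRank_eq_zero_of_selmerCorank_eq_zero_of_hasCM)
    (hH : hasEntireLFunction_of_j_mem_maximalCMJInvariants) (hBF : bsdTriple_of_hasCM_of_L_one_ne_zero) :
    BSDp (congruentNumberCurve 105) 2 :=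
  bsdp_two_congruentNumberCurve_of_det_odd_descent ![3, 5, 7] hBT hH hBF (by intro i; fin_cases i <;> norm_num) (by intro i; fin_cases i <;> decide) (by decide) det_monskyMatrixOdd_105 (by simp [Fin.prod_univ_succ])

/-- **`#Sel⁽²⁾(E_{107}/ℚ) = 4` — UNCONDITIONAL** (`det M = 1` for `n = 107`, `det_monskyMatrixOdd_107`; hence rank `0`, `Ш[2^∞] = 0`).
[cite: HeathBrown1994SelmerCongruentII, Appendix (Monsky), typescript p. 39 L10–L33] [cite: SilvermanAEC2009, Thm. X.4.2] -/
theorem card_selmerGroup_two_congruentNumberCurve_107 : Nat.card ((congruentNumberCurve 107).selmerGroup 2) = 4 :=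
  card_selmerGroup_two_eq_four_of_det_odd' ![107] (by simp) (by intro i; fin_cases i; norm_num) (by intro i; fin_cases i; decide) (by decide) det_monskyMatrixOdd_107

/-- **`BSD(E_{107}, 2)` WITHOUT Monsky's fact** — journal door {`hBT`, `hH`, `hBF`} only; membership `s(107) = 0` by `det_monskyMatrixOdd_107`.
[cite: BurungaleTian2026, Thm. 1.1] [cite: BurungaleFlach2024, Cor. 2] [cite: Miller2011LMS, Def. 1.1] -/
theorem bsdp_two_congruentNumberCurve_107_descent
    (hBT : burungaleTian_analyticRank_eq_zero_of_selmerCorank_eq_zero_of_hasCM)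
    (hH : hasEntireLFunction_of_j_mem_maximalCMJInvariants) (hBF : bsdTriple_of_hasCM_of_L_one_ne_zero) :
    BSDp (congruentNumberCurve 107) 2 :=
  bsdp_two_congruentNumberCurve_of_det_odd_descent ![107] hBT hH hBF (by intro i; fin_cases i; norm_num) (by intro i; fin_cases i; decide) (by decide) det_monskyMatrixOdd_107 (by simp)

/-- **`#Sel⁽²⁾(E_{115}/ℚ) = 4` — UNCONDITIONAL** (`det M = 1` for `n = 115`, `det_monskyMatrixOdd_115`; hence rank `0`, `Ш[2^∞] = 0`).
[cite: HeathBrown1994SelmerCongruentII, Appendix (Monsky), typescript p. 39 L10–L33] [cite: SilvermanAEC2009, Thm. X.4.2] -/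
theorem card_selmerGroup_two_congruentNumberCurve_115 : Nat.card ((congruentNumberCurve 115).selmerGroup 2) = 4 :=
  card_selmerGroup_two_eq_four_of_det_odd' ![5, 23] (by simp [Fin.prod_univ_succ]) (by intro i; fin_cases i <;> norm_num) (by intro i; fin_cases i <;> decide) (by decide) det_monskyMatrixOdd_115

/-- **`BSD(E_{115}, 2)` WITHOUT Monsky's fact** — journal door {`hBT`, `hH`, `hBF`} only; membership `s(115) = 0` by `det_monskyMatrixOdd_115`.
[cite: BurungaleTian2026, Thm. 1.1] [cite: BurungaleFlach2024, Cor. 2] [cite: Miller2011LMS, Def. 1.1] -/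
theorem bsdp_two_congruentNumberCurve_115_descent
    (hBT : burungaleTian_analyticRank_eq_zero_of_selmerCorank_eq_zero_of_hasCM)
    (hH : hasEntireLFunction_of_j_mem_maximalCMJInvariants) (hBF : bsdTriple_of_hasCM_of_L_one_ne_zero) :
    BSDp (congruentNumberCurve 115) 2 :=
  bsdp_two_congruentNumberCurve_of_det_odd_descent ![5, 23] hBT hH hBF (by intro i; fin_cases i <;> norm_num) (by intro i; fin_cases i <;> decide) (by decide) det_monskyMatrixOdd_115 (by simp [Fin.prod_univ_succ])

/-- **`#Sel⁽²⁾(E_{123}/ℚ) = 4` — UNCONDITIONAL** (`det M = 1` for `n = 123`, `det_monskyMatrixOdd_123`; hence rank `0`, `Ш[2^∞] = 0`).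
[cite: HeathBrown1994SelmerCongruentII, Appendix (Monsky), typescript p. 39 L10–L33] [cite: SilvermanAEC2009, Thm. X.4.2] -/
theorem card_selmerGroup_two_congruentNumberCurve_123 : Nat.card ((congruentNumberCurve 123).selmerGroup 2) = 4 :=
  card_selmerGroup_two_eq_four_of_det_odd' ![3, 41] (by simp [Fin.prod_univ_succ]) (by intro i; fin_cases i <;> norm_num) (by intro i; fin_cases i <;> decide) (by decide) det_monskyMatrixOdd_123

/-- **`BSD(E_{123}, 2)` WITHOUT Monsky's fact** — journal door {`hBT`, `hH`, `hBF`} only; membership `s(123) = 0` by `det_monskyMatrixOdd_123`.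
[cite: BurungaleTian2026, Thm. 1.1] [cite: BurungaleFlach2024, Cor. 2] [cite: Miller2011LMS, Def. 1.1] -/
theorem bsdp_two_congruentNumberCurve_123_descent
    (hBT : burungaleTian_analyticRank_eq_zero_of_selmerCorank_eq_zero_of_hasCM)
    (hH : hasEntireLFunction_of_j_mem_maximalCMJInvariants) (hBF : bsdTriple_of_hasCM_of_L_one_ne_zero) :
    BSDp (congruentNumberCurve 123) 2 :=
  bsdp_two_congruentNumberCurve_of_det_odd_descent ![3, 41] hBT hH hBF (by intro i; fin_cases i <;> norm_num) (by intro i; fin_cases i <;> decide) (by decide) det_monskyMatrixOdd_123 (by simp [Fin.prod_univ_succ])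

/-- **ROLL-UP (odd `n`), UNCONDITIONAL**: `#Sel⁽²⁾(E_n/ℚ) = 4` for every odd `n ∈ U_CN` with `s(n) = 0`, the list `[1, 3, 11, 19, 33, 35, 43, 51, 57, 59, 67, 83, 91, 105, 107, 115, 123]`
(17 curves). No named fact. [cite: HeathBrown1994SelmerCongruentII, Appendix (Monsky), typescript p. 39 L10–L33] [cite: SilvermanAEC2009, Thm. X.4.2] -/
theorem card_selmerGroup_two_eq_four_of_mem_oddList :
    ∀ n ∈ ([1, 3, 11, 19, 33, 35, 43, 51, 57, 59, 67, 83, 91, 105, 107, 115, 123] : List ℕ), Nat.card ((congruentNumberCurve n).selmerGroup 2) = 4 := by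
  intro n hn
  simp only [List.mem_cons, List.not_mem_nil, or_false] at hn
  rcases hn with rfl | rfl | rfl | rfl | rfl | rfl | rfl | rfl | rfl | rfl | rfl | rfl | rfl | rfl | rfl | rfl | rfl
  exacts [card_selmerGroup_two_congruentNumberCurve_1, card_selmerGroup_two_congruentNumberCurve_3, card_selmerGroup_two_congruentNumberCurve_11, card_selmerGroup_two_congruentNumberCurve_19, card_selmerGroup_two_congruentNumberCurve_33, card_selmerGroup_two_congruentNumberCurve_35, card_selmerGroup_two_congruentNumberCurve_43, card_selmerGroup_two_congruentNumberCurve_51, card_selmerGroup_two_congruentNumberCurve_57, card_selmerGroup_two_congruentNumberCurve_59, card_selmerGroup_two_congruentNumberCurve_67, card_selmerGroup_two_congruentNumberCurve_83, card_selmerGroup_two_congruentNumberCurve_91, card_selmerGroup_two_congruentNumberCurve_105, card_selmerGroup_two_congruentNumberCurve_107, card_selmerGroup_two_congruentNumberCurve_115, card_selmerGroup_two_congruentNumberCurve_123]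

/-- **Rank `0` and `Ш[2^∞] = 0` for these 17 curves, UNCONDITIONALLY** (from `#Sel₂ = 4`: the descent count, Silverman X.4.2).
[cite: SilvermanAEC2009, Thm. X.4.2] [cite: HeathBrown1994SelmerCongruentII, §1 typescript p. 1 L18–L20] -/
theorem rank_zero_sha_two_of_mem_oddList :
    ∀ n ∈ ([1, 3, 11, 19, 33, 35, 43, 51, 57, 59, 67, 83, 91, 105, 107, 115, 123] : List ℕ), ∃ hn : n ≠ 0,
      (haveI := isElliptic_congruentNumberCurve hn; (congruentNumberCurve n).mordellWeilRank = 0) ∧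
      (haveI := isElliptic_congruentNumberCurve hn; AddCommGroup.primaryComponent (congruentNumberCurve n).sha 2 = ⊥) := by
  intro n hn
  have h4 := card_selmerGroup_two_eq_four_of_mem_oddList n hn
  have hn0 : n ≠ 0 := by
    simp only [List.mem_cons, List.not_mem_nil, or_false] at hn
    rcases hn with rfl | rfl | rfl | rfl | rfl | rfl | rfl | rfl | rfl | rfl | rfl | rfl | rfl | rfl | rfl | rfl | rfl <;> decide
  exact ⟨hn0, Smith2016.mordellWeilRank_eq_zero_of_card_selmerGroup_two hn0 h4,
    Smith2016.primaryComponent_sha_two_eq_bot_of_card_selmerGroup_two hn0 h4⟩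

/-- **ROLL-UP (odd `n`) WITHOUT Monsky's fact**: `BSD(E_n, 2)` for every odd `n ∈ U_CN` with `s(n) = 0` (17 pairs), journal door modulo
{`hBT`, `hH`, `hBF`} ONLY. [cite: BurungaleTian2026, Thm. 1.1] [cite: BurungaleFlach2024, Cor. 2] [cite: Miller2011LMS, Def. 1.1] -/
theorem bsdp_two_congruentNumberCurve_of_mem_oddList_descent
    (hBT : burungaleTian_analyticRank_eq_zero_of_selmerCorank_eq_zero_of_hasCM)
    (hH : hasEntireLFunction_of_j_mem_maximalCMJInvariants) (hBF : bsdTriple_of_hasCM_of_L_one_ne_zero) :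
    ∀ n ∈ ([1, 3, 11, 19, 33, 35, 43, 51, 57, 59, 67, 83, 91, 105, 107, 115, 123] : List ℕ), BSDp (congruentNumberCurve n) 2 := by
  intro n hn
  simp only [List.mem_cons, List.not_mem_nil, or_false] at hn
  rcases hn with rfl | rfl | rfl | rfl | rfl | rfl | rfl | rfl | rfl | rfl | rfl | rfl | rfl | rfl | rfl | rfl | rfl
  exacts [bsdp_two_congruentNumberCurve_1_descent hBT hH hBF, bsdp_two_congruentNumberCurve_3_descent hBT hH hBF, bsdp_two_congruentNumberCurve_11_descent hBT hH hBF, bsdp_two_congruentNumberCurve_19_descent hBT hH hBF, bsdp_two_congruentNumberCurve_33_descent hBT hH hBF, bsdp_two_congruentNumberCurve_35_descent hBT hH hBF, bsdp_two_congruentNumberCurve_43_descent hBT hH hBF, bsdp_two_congruentNumberCurve_51_descent hBT hH hBF, bsdp_two_congruentNumberCurve_57_descent hBT hH hBF, bsdp_two_congruentNumberCurve_59_descent hBT hH hBF, bsdp_two_congruentNumberCurve_67_descent hBT hH hBF, bsdp_two_congruentNumberCurve_83_descent hBT hH hBF, bsdp_two_congruentNumberCurve_91_descent hBT hH hBF,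 bsdp_two_congruentNumberCurve_105_descent hBT hH hBF, bsdp_two_congruentNumberCurve_107_descent hBT hH hBF, bsdp_two_congruentNumberCurve_115_descent hBT hH hBF, bsdp_two_congruentNumberCurve_123_descent hBT hH hBF]

end Instances

end Summit.BirchSwinnertonDyer.Rank1Residual.P2

end
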